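import Mathlib.FieldTheory.Galois.Basic
import Literature.AlgebraicGeometry.Resolution.KrullRamificationGroups
import Literature.AlgebraicGeometry.CossartPiltant200819.TameSegment2008
import Literature.AlgebraicGeometry.Ramification.InertiaNormalSylow
import Literature.AlgebraicGeometry.Ramification.NormalSylowExtensions
import HarnessLib

/-!
# The inertia group of a valuation is p-closed — the valuative bound on limiting inertia in Phase 0
# (crux `WildQuotients.WildQuotientResolution`, stub `stub_phaseZeroHighDim`)

Crux stmt-ResolutionOfSingularities-15640 (`WildQuotientResolution`), line `Sketch` (card
`p-closure-sylow-separation`), registered stub `stub_phaseZeroHighDim`: a `G`-equivariant regular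
modification of the regular `G`-scheme `X′` on which every inertia group (Abbes–Saito 2011, 2.4; the
tree's `Literature.AlgebraicGeometry.Ramification.inertiaSubgroup`) has a normal Sylow `p`-subgroup
("p-closed", `HasNormalSylow`). The inertia half of this stub is Abbes–Saito 2011, Prop. 2.22 (the
tree's named fact `AbbesSaito2011_inertiaNormalSylow_after_admissibleBlowup`): after a `U`-admissible
blow-up and normalisation ALL inertia groups are p-closed, in every dimension; its proof rests on one
valuation-theoretic input, AS2011 Lemma 2.10 — the inertia group of a (strictly henselian) valuation
ring of residue characteristic `p` is an extension of an ABELIAN prime-to-`p` group by a `p`-GROUP, hence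
p-closed — applied on the Zariski–Riemann space. This file proves the finite-level form of that input
from the tree's Zariski–Samuel VI §12 development (`Resolution.KrullRamificationGroups`:
`G_V ⊴ G_T`, `G_V` a `p`-group (Thm. 24), `(G_T : G_V)` prime to `p` (Thm. 25)) and packages it in
the three shapes Phase 0 consumes:

* `hasNormalSylow_inertiaGroupIn` — **`G_T(V)` is p-closed** (ambient form `(Ω, V)`, `L/F` finite
  inside `Ω`): the large ramification group `G_V` is a normal Sylow `p`-subgroup of the inertia group;
  `hasNormalSylow_of_le_inertiaGroupIn` — so is every subgroup of `G_T`.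
* `hasNormalSylow_inertiaGroup` — the same for a finite extension `L/K` and a valuation ring `W` of
  `L` (the `CP2008.inertiaGroup W ≤ Gal(L/K)` form, through the transport `CP2008.autTopHom`);
  `hasNormalSylow_of_forall_mem_inertiaGroup` — an abstract finite group `G` mapping injectively
  into `Gal(L/K)` with image inside `G_T(W)` is p-closed (the shape a faithful scheme action
  `G →* Aut X′` produces on the function field).
* `mem_inertiaGroupIn_of_residuallyDense` — **the exhaustion criterion**: an automorphism `σ` in the
  decomposition group which is residue-trivial on a subset `S ⊆ V ∩ L` that is DENSE modulo `𝔐_V`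
  (every `x ∈ V ∩ L` is congruent to some `s ∈ S`) lies in `G_T`. Along a tower of equivariant
  blow-ups `… → X₂ → X₁ → X′` following a valuation `v` of the function field with centres `yₙ`, the
  local rings `𝒪_{Xₙ,yₙ}` form such an `S` as soon as their residue fields exhaust `κ(v)`; then the
  limiting inertia `⋂ₙ I_{yₙ}` lies in `G_T(v)` and is p-closed — the termination witness of the
  Phase-0 game along every valuation (hand leafhand-res-wildquotients-4's item (iv)), and the reason
  AS2011 2.22 holds on the Zariski–Riemann space.

[OURS · crux stmt-ResolutionOfSingularities-15640 · helper toward `stub_phaseZeroHighDim`; the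
mathematics is Zariski–Samuel VI §12 Thms 24–25 / Abbes–Saito 2011 Lemma 2.10 (finite level), counted 0;
AI-level work, weaker than expert review.]

References: O. Zariski, P. Samuel, *Commutative Algebra* II, Ch. VI §12, Thm. 24 (p. 77), Thm. 25
(p. 78) [ZariskiSamuel1960]; A. Abbes, T. Saito, *Ramification and cleanliness*, Tohoku Math. J. 63
(2011), Lemma 2.10, Prop. 2.22 [AbbesSaito2011].
-/

-- single-problem summit: the doubled namespace component `ResolutionOfSingularities` is forced
set_option linter.dupNamespace false

noncomputable section

open IsLocalRing IntermediateField
open Literature.AlgebraicGeometry.Resolution Literature.AlgebraicGeometry.Ramification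
open Literature.AlgebraicGeometry.CossartPiltant200819
open scoped Pointwise

namespace Summit.ResolutionOfSingularities.ResolutionOfSingularities.Theorems.WildQuotientResolution.ValuationInertia

universe u

/-! ## Ambient form: `G_T(V)` for `L/F` finite inside a valued field `(Ω, V)` -/

section Ambient

variable {Ω : Type u} [Field Ω] (V : ValuationSubring Ω) {F : Subfield Ω}
  (L : IntermediateField F Ω)

/-- **The inertia group of a valuation is p-closed** (Zariski–Samuel VI §12, Thms 24–25; the
finite-level form of Abbes–Saito 2011, Lemma 2.10): for `L/F` finite inside the valued field
`(Ω, V)` with residue characteristic `p`, the large ramification group `G_V` is a normal `p`-subgroup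
of the inertia group `G_T` of index prime to `p`, hence a normal Sylow `p`-subgroup of `G_T`.
[cite: ZariskiSamuel1960, Ch. VI §12, Thm. 24 p. 77, Thm. 25 p. 78]
[cite: AbbesSaito2011, Lemma 2.10] -/
theorem hasNormalSylow_inertiaGroupIn {p : ℕ} [Fact p.Prime] [CharP (ResidueField V) p]
    [FiniteDimensional F L] : HasNormalSylow p (inertiaGroupIn V L) := by
  haveI := normal_ramificationGroupIn_subgroupOf_inertiaGroupIn V L
  exact HasNormalSylow.of_normal_of_not_dvd_index
    ((ramificationGroupIn V L).subgroupOf (inertiaGroupIn V L))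
    ((isPGroup_ramificationGroupIn V L).comap_subtype)
    ((Nat.Prime.coprime_iff_not_dvd (Fact.out : p.Prime)).mp (coprime_index_ramificationGroupIn V L))

/-- **Every subgroup of the inertia group of a valuation is p-closed** (subgroups inherit a
normal Sylow `p`-subgroup, `HasNormalSylow.subgroup`). This is the form in which the bound is used:
a group of automorphisms fixing a valuation ring and acting trivially on its residue field is
p-closed. [cite: ZariskiSamuel1960, Ch. VI §12, Thms 24–25] -/
theorem hasNormalSylow_of_le_inertiaGroupIn {p : ℕ} [Fact p.Prime] [CharP (ResidueField V) p]
    [FiniteDimensional F L] {H : Subgroup (L ≃ₐ[F] L)} (hH : H ≤ inertiaGroupIn V L) :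
    HasNormalSylow p H :=
  ((hasNormalSylow_inertiaGroupIn V L).subgroup (H.subgroupOf (inertiaGroupIn V L))).of_mulEquiv
    (Subgroup.subgroupOfEquivOfLe hH)

/-- **Exhaustion criterion for the inertia group**: let `σ ∈ G_Z` (so `σ` stabilises `V ∩ L` and
its maximal ideal) be residue-trivial on a subset `S ⊆ V ∩ L` — `v(σ s − s) < 1` for `s ∈ S` — which
is dense modulo `𝔐_V`: every `x ∈ V ∩ L` has `v(x − s) < 1` for some `s ∈ S`. Then `σ ∈ G_T`:
`σ x − x = σ(x − s) + (σ s − s) + (s − x)` has value `< 1`. (Along a blow-up tower following `v` with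
`σ` in every inertia group `I_{yₙ}`, take `S = ⋃ₙ 𝒪_{Xₙ,yₙ}` once the residue fields `κ(yₙ)` exhaust
`κ(v)`.) [folklore; cf. AbbesSaito2011, 2.20–2.21] -/
theorem mem_inertiaGroupIn_of_residuallyDense {σ : L ≃ₐ[F] L} (hσ : σ ∈ decompositionGroupIn V L)
    (S : Set L) (hdense : ∀ x : L, (x : Ω) ∈ V → ∃ s ∈ S, V.valuation ((x : Ω) - s) < 1)
    (htriv : ∀ s ∈ S, V.valuation (((σ s : L) : Ω) - s) < 1) :
    σ ∈ inertiaGroupIn V L := by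
  refine ⟨(mem_decompositionGroupIn_iff V L σ).mp hσ, fun x hx => ?_⟩
  obtain ⟨s, hsS, hxs⟩ := hdense x hx
  have h1 : V.valuation (((σ (x - s) : L) : Ω)) < 1 := by
    have h := (valuation_lt_one_iff_of_mem_decompositionGroupIn V L hσ (x - s)).mp (by push_cast; exact hxs)
    exact h
  have h2 : V.valuation (((σ s : L) : Ω) - s) < 1 := htriv s hsS
  have h3 : V.valuation ((s : Ω) - x) < 1 := by
    rw [← Valuation.map_neg, neg_sub]; exact hxs
  have h12 := Valuation.map_add_lt V.valuation h1 h2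
  have h123 := Valuation.map_add_lt V.valuation h12 h3
  have key : ((σ x : L) : Ω) - x = ((σ (x - s) : L) : Ω) + (((σ s : L) : Ω) - s) + ((s : Ω) - x) := by
    rw [map_sub]; push_cast; ring
  rw [key]
  exact h123

/-- **Residue-trivial on a residually dense stable subset ⇒ p-closed**: a subgroup `H ≤ G_Z` all
of whose elements are residue-trivial on a residually dense `S ⊆ V ∩ L` lies in `G_T`, hence is
p-closed. The limiting inertia group of a blow-up tower following a valuation, once the residue
fields of the centres exhaust the residue field of the valuation, is of this form.
[cite: ZariskiSamuel1960, Ch. VI §12, Thms 24–25] -/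
theorem hasNormalSylow_of_residuallyDense {p : ℕ} [Fact p.Prime] [CharP (ResidueField V) p]
    [FiniteDimensional F L] {H : Subgroup (L ≃ₐ[F] L)} (hH : H ≤ decompositionGroupIn V L)
    (S : Set L) (hdense : ∀ x : L, (x : Ω) ∈ V → ∃ s ∈ S, V.valuation ((x : Ω) - s) < 1)
    (htriv : ∀ σ ∈ H, ∀ s ∈ S, V.valuation (((σ s : L) : Ω) - s) < 1) :
    HasNormalSylow p H :=
  hasNormalSylow_of_le_inertiaGroupIn V L fun σ hσ =>
    mem_inertiaGroupIn_of_residuallyDense V L (hH hσ) S hdense (htriv σ hσ)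

end Ambient

/-! ## The `Gal(L/K)` form: a valuation ring `W` of the top field `L` -/

section Top

variable {K L : Type u} [Field K] [Field L] [Algebra K L]

/-- **`G_T(W/W ∩ K)` is p-closed** for a finite extension `L/K` and a valuation ring `W` of `L` of
residue characteristic `p` (the `CP2008.inertiaGroup` form: Mathlib's inertia subgroup of the
decomposition subgroup, pushed into `Gal(L/K)`), transported from the ambient form along the
injective `CP2008.autTopHom` (`CP2008.autTopHom_mem_inertiaGroupIn_iff`).
[cite: ZariskiSamuel1960, Ch. VI §12, Thms 24–25] [cite: AbbesSaito2011, Lemma 2.10] -/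
theorem hasNormalSylow_inertiaGroup {p : ℕ} [Fact p.Prime] [FiniteDimensional K L]
    (W : ValuationSubring L) [CharP (ResidueField W) p] :
    HasNormalSylow p (CP2008.inertiaGroup (K := K) W) := by
  haveI := CP2008.finiteDimensional_top_baseSubfield (K := K) (L := L)
  -- the image of `G_T(W)` under `autTopHom` lies in the ambient inertia group
  have hle : (CP2008.inertiaGroup (K := K) W).map CP2008.autTopHom ≤
      inertiaGroupIn W (⊤ : IntermediateField (CP2008.baseSubfield K L) L) := by
    rintro _ ⟨σ, hσ, rfl⟩
    exact (CP2008.autTopHom_mem_inertiaGroupIn_iff W σ).mpr hσ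
  exact (hasNormalSylow_of_le_inertiaGroupIn W _ hle).of_mulEquiv
    ((CP2008.inertiaGroup (K := K) W).equivMapOfInjective CP2008.autTopHom
      CP2008.autTopHom_injective).symm

/-- **Subgroups of `G_T(W)` are p-closed.** [cite: ZariskiSamuel1960, Ch. VI §12, Thms 24–25] -/
theorem hasNormalSylow_of_le_inertiaGroup {p : ℕ} [Fact p.Prime] [FiniteDimensional K L]
    (W : ValuationSubring L) [CharP (ResidueField W) p] {H : Subgroup (L ≃ₐ[K] L)}
    (hH : H ≤ CP2008.inertiaGroup (K := K) W) : HasNormalSylow p H :=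
  ((hasNormalSylow_inertiaGroup (K := K) W).subgroup
    (H.subgroupOf (CP2008.inertiaGroup (K := K) W))).of_mulEquiv (Subgroup.subgroupOfEquivOfLe hH)

/-- **An abstract finite group acting faithfully inside the inertia group of a valuation is
p-closed**: if `φ : G → Gal(L/K)` is injective and every `φ g` fixes the valuation ring `W` and acts
trivially on its residue field (`v(φ g · x − x) < 1` on `W`), then `G` has a normal Sylow
`p`-subgroup. This is the shape produced by a faithful action `G →* Aut X′` of a finite group on an
integral scheme through its function field `L = K(X′)`, `K` any subfield fixed by `G`: the elements
of `G` that fix a valuation `v` of `K(X′)` and act trivially on `κ(v)` form a p-closed group — the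
valuative bound on the limiting inertia of Phase 0.
[cite: ZariskiSamuel1960, Ch. VI §12, Thms 24–25] [cite: AbbesSaito2011, Lemma 2.10] -/
theorem hasNormalSylow_of_forall_mem_inertiaGroup {p : ℕ} [Fact p.Prime] [FiniteDimensional K L]
    (W : ValuationSubring L) [CharP (ResidueField W) p] {G : Type*} [Group G]
    (φ : G →* (L ≃ₐ[K] L)) (hφ : Function.Injective φ)
    (hW : ∀ g : G, φ g • W = W) (hres : ∀ (g : G) (x : L), x ∈ W → W.valuation (φ g x - x) < 1) :
    HasNormalSylow p G := by
  have hle : φ.range ≤ CP2008.inertiaGroup (K := K) W := by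
    rintro _ ⟨g, rfl⟩
    exact (CP2008.mem_inertiaGroup_iff' W (φ g)).mpr ⟨hW g, hres g⟩
  exact (hasNormalSylow_of_le_inertiaGroup (K := K) W hle).of_mulEquiv (MonoidHom.ofInjective hφ).symm

/-- **Residue characteristic from the ground field**: if `L` is an algebra over a field `k` of
characteristic `p` and `W` contains (the image of) `k` — automatic for a valuation ring of a function
field over `k` centred on a `k`-scheme — then the residue field of `W` has characteristic `p`, so the
three theorems above apply with the prime of the summit (`CP2008.charP_residueField`).
[folklore] -/
theorem hasNormalSylow_inertiaGroup_of_charP {p : ℕ} [Fact p.Prime] [FiniteDimensional K L]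
    {k : Type u} [Field k] [CharP k p] [Algebra k L] (W : ValuationSubring L)
    (hkW : ∀ c : k, algebraMap k L c ∈ W) :
    HasNormalSylow p (CP2008.inertiaGroup (K := K) W) := by
  haveI := CP2008.charP_residueField (L := L) p W hkW
  exact hasNormalSylow_inertiaGroup (K := K) W

end Top

end Summit.ResolutionOfSingularities.ResolutionOfSingularities.Theorems.WildQuotientResolution.ValuationInertia

end
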